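import Mathlib
import HarnessLib
import Literature.Analysis.FluidPDE.KNSSSwirlTransport
import Literature.Analysis.FluidPDE.KNSSSwirlSupNonpos
import Literature.Analysis.FluidPDE.KNSSLemma21Proof
import Summits.NavierStokesRegularity.NavierStokesRegularity.Theorems.HalfSpaceWindowDoorCirculationCarryingRigidityDefs

/-!
# Route `HalfSpaceWindowDoor`, crux `CirculationCarryingRigidity` (stmt-NavierStokesRegularity-25311) — the SOURCED SWIRL
# LIOUVILLE TOOL, part 1: KNSS's swirl pair with an extra radial drift (structure, covariance, Lemma 2.1 data)

The non-local ingredient of line `extremal`'s census (LEAD ns-hsw-p1 g3).  Koch–Nadirashvili–Seregin–Šverák (Acta Math. 203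
(2009), proof of Thm 5.3; tree: `Literature.Analysis.FluidPDE.KNSS2009_swirl_sup_nonpos_of_lemma21`, file
`KNSSSwirlSupNonpos`) prove: a bounded axisymmetric ancient solution `f` of the swirl equation
`fₜ + u·∇f = Δf − (2/r)∂ᵣf` with a divergence-free drift `|u| ≤ C/r`, vanishing on the axis, satisfies `f ≤ 0`.  For the DISC
CIRCULATION `Γ(r,z,s) = ∫_{D(r,z)} ω₃` of a closed-hemisphere profile (AxisTwistDoor's circle-averaged swirl law,
`…AxisTwistDoorAveragedConeLiouvilleCircleSwirl.circleSwirlEquation_of_classical`) the same equation holds UP TO the transport of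
`Γ` by the circle means and the fluctuation remainder, all of which are, under the circle-averaged cone condition, of the form
`β ∂ᵣΓ` with `|β| ≲ sup_{S(r,z)}|v|` — an extra, NOT divergence-free, RADIAL drift.  This file and its sequels re-run KNSS's
argument for

  `fₜ + (u + β e_r)·∇f = Δf − (2/r)∂ᵣf`,   `∂ᵣf ≥ 0`,   `|β| r ≤ A`,   `|β| √(τ − t) ≤ A`

(`…Defs.IsSourcedSwirl`, p632525): the `1/r` bound keeps Lemma 2.1 applicable away from the axis uniformly under rescaling, the `1/√(τ−t)` bound
makes the new weak-form term `∫∫ β ∂ᵣf φ` of size `O(L √T)` against the axis term `≍ M L T` (sequel files).  Here: the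
structure, its restriction to earlier final times, its scaling/translation covariance (`rescale`, KNSS (5.11)–(5.13)), the
data of Lemma 2.1 on regions away from the axis with the merged drift `u + (2/r + β)e_r` (`lemma21_data`), the supremum
(`exists_sup`) and the joint continuity of the scalar.  Proofs are the tree's (`KNSSSwirlTransport`, `KNSSSwirlSupNonpos`) with
the extra drift carried along.

Seat ns-hsw-p1 g3 (LEAD of 25311, cell pub-ns-dss).  WHAT THIS IS NOT: not a statement about Navier–Stokes regularity; a linear
parabolic Liouville tool; helper `--supports` 25311.
-/

noncomputable section

-- the summit and its single sub-problem share the name (CONVENTIONS §1), as in every Theorems file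
set_option linter.dupNamespace false

namespace Summit.NavierStokesRegularity.NavierStokesRegularity.Theorems.HalfSpaceWindowDoorCirculationCarryingRigiditySourcedSwirl

open MeasureTheory Set Function Filter Topology TopologicalSpace InnerProductSpace WithLp Metric
open scoped Laplacian RealInnerProductSpace ContDiff
open Literature.Analysis Literature.Analysis.FluidPDE
open Summit.NavierStokesRegularity.NavierStokesRegularity.Theorems.HalfSpaceWindowDoorCirculationCarryingRigidityDefs

namespace IsSourcedSwirl

variable {Cf Cu A τ : ℝ} {f : ℝ → (EuclideanSpace ℝ (Fin 3)) → ℝ} {u : ℝ → (EuclideanSpace ℝ (Fin 3)) → (EuclideanSpace ℝ (Fin 3))} {β : ℝ → (EuclideanSpace ℝ (Fin 3)) → ℝ}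

/-- `C_f ≥ 0`. -/
theorem Cf_nonneg (h : IsSourcedSwirl Cf Cu A τ f u β) : 0 ≤ Cf :=
  (abs_nonneg _).trans (h.abs_le (τ - 1) (by linarith) 0)

/-- `C_u ≥ 0`. -/
theorem Cu_nonneg (h : IsSourcedSwirl Cf Cu A τ f u β) : 0 ≤ Cu :=
  (mul_nonneg (cylRadius_nonneg _) (norm_nonneg _)).trans (h.drift_le (τ - 1) (by linarith) 0)

/-- The underlying data WITHOUT the equation is not a KNSS pair, but every field other than the equation is shared; in
particular the tree's joint-continuity argument applies verbatim: **the scalar is jointly continuous** on `(−∞, τ) × ℝ³`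
(`f(t,x) = ∫₀¹ Df(t, θx)[x] dθ` since `f = 0` on the axis). -/
theorem continuousOn_uncurry (h : IsSourcedSwirl Cf Cu A τ f u β) :
    ContinuousOn (uncurry f) (Iio τ ×ˢ univ) := by
  set S : Set (ℝ × (EuclideanSpace ℝ (Fin 3))) := Iio τ ×ˢ univ with hS
  have hrep : ∀ p ∈ S, uncurry f p = ∫ θ in (0 : ℝ)..1, fderiv ℝ (f p.1) (θ • p.2) p.2 := by
    rintro ⟨t, x⟩ ⟨ht, -⟩
    have hd : Differentiable ℝ (f t) := (h.smooth t ht).differentiable (by simp)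
    have hg : ∀ θ, HasDerivAt (fun θ : ℝ => f t (θ • x)) (fderiv ℝ (f t) (θ • x) x) θ := by
      intro θ
      have h1 : HasDerivAt (fun θ : ℝ => θ • x) x θ := by
        simpa using (hasDerivAt_id θ).smul_const x
      exact (hd (θ • x)).hasFDerivAt.comp_hasDerivAt θ h1
    have hc : Continuous fun θ : ℝ => fderiv ℝ (f t) (θ • x) x :=
      (((h.smooth t ht).continuous_fderiv (by simp)).comp (continuous_id.smul continuous_const)).clm_apply
        continuous_const
    rw [intervalIntegral.integral_eq_sub_of_hasDerivAt (fun θ _ => hg θ) (hc.intervalIntegrable _ _)]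
    simp only [uncurry_apply_pair, one_smul, zero_smul]
    rw [h.axis t ht 0 (by simp [cylRadius]), sub_zero]
  have hcont : ContinuousOn (fun p : ℝ × (EuclideanSpace ℝ (Fin 3)) => ∫ θ in (0 : ℝ)..1, fderiv ℝ (f p.1) (θ • p.2) p.2) S := by
    rw [continuousOn_iff_continuous_restrict]
    have hH : Continuous (uncurry fun (q : S) (θ : ℝ) => fderiv ℝ (f q.1.1) (θ • q.1.2) q.1.2) := by
      have hmap : Continuous fun z : S × ℝ => ((z.1.1.1, z.2 • z.1.1.2) : ℝ × (EuclideanSpace ℝ (Fin 3))) := by fun_prop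
      have hmaps : ∀ z : S × ℝ, ((z.1.1.1, z.2 • z.1.1.2) : ℝ × (EuclideanSpace ℝ (Fin 3))) ∈ S := fun z =>
        ⟨z.1.2.1, mem_univ _⟩
      have h1 : Continuous fun z : S × ℝ => fderiv ℝ (f z.1.1.1) (z.2 • z.1.1.2) :=
        h.continuousOn_fderiv.comp_continuous hmap hmaps
      exact h1.clm_apply (by fun_prop)
    exact intervalIntegral.continuous_parametric_intervalIntegral_of_continuous' hH 0 1
  exact hcont.congr hrep

/-- The scalar is jointly a.e.-strongly measurable on measurable subsets of the slab (restricted measures). -/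
theorem aestronglyMeasurable_uncurry (h : IsSourcedSwirl Cf Cu A τ f u β)
    {μ : Measure (ℝ × (EuclideanSpace ℝ (Fin 3)))} {S : Set (ℝ × (EuclideanSpace ℝ (Fin 3)))} (hS : MeasurableSet S) (hSτ : S ⊆ Iio τ ×ˢ univ) :
    AEStronglyMeasurable (uncurry f) (μ.restrict S) :=
  ((continuousOn_uncurry h).mono hSτ).aestronglyMeasurable hS

/-- Where the radial derivative vanishes off the axis, so does the extra drift term (`|β| r ≤ A` is not needed for this: it is
the product `β ∂ᵣf` that enters the equation). Recorded form: `|β ∂ᵣf| ≤ (A / r) ∂ᵣf` off the axis. -/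
theorem abs_beta_mul_le_radial (h : IsSourcedSwirl Cf Cu A τ f u β) {t : ℝ} (ht : t < τ) {x : (EuclideanSpace ℝ (Fin 3))}
    (hx : cylRadius x ≠ 0) :
    |β t x * fderiv ℝ (f t) x (eR x)| ≤ A / cylRadius x * fderiv ℝ (f t) x (eR x) := by
  have hr : 0 < cylRadius x := lt_of_le_of_ne (cylRadius_nonneg x) (Ne.symm hx)
  have hD := h.radial_nonneg t ht x
  have hb : |β t x| ≤ A / cylRadius x := by
    rw [le_div_iff₀ hr]; exact h.beta_le_radial t ht x
  rw [abs_mul, abs_of_nonneg hD]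
  exact mul_le_mul_of_nonneg_right hb hD

/-- `|β ∂ᵣf| ≤ (A / √(τ − t)) ∂ᵣf` for `t < τ`. -/
theorem abs_beta_mul_le_time (h : IsSourcedSwirl Cf Cu A τ f u β) {t : ℝ} (ht : t < τ) (x : (EuclideanSpace ℝ (Fin 3))) :
    |β t x * fderiv ℝ (f t) x (eR x)| ≤ A / Real.sqrt (τ - t) * fderiv ℝ (f t) x (eR x) := by
  have hs : 0 < Real.sqrt (τ - t) := Real.sqrt_pos.2 (by linarith)
  have hD := h.radial_nonneg t ht x
  have hb : |β t x| ≤ A / Real.sqrt (τ - t) := by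
    rw [le_div_iff₀ hs]; exact h.beta_le_time t ht x
  rw [abs_mul, abs_of_nonneg hD]
  exact mul_le_mul_of_nonneg_right hb hD

/-- Restriction to an earlier final time (the time bound `|β|√(τ' − t) ≤ |β|√(τ − t) ≤ A` only improves). -/
theorem mono (h : IsSourcedSwirl Cf Cu A τ f u β) {τ' : ℝ} (hτ : τ' ≤ τ) : IsSourcedSwirl Cf Cu A τ' f u β where
  smooth t ht := h.smooth t (lt_of_lt_of_le ht hτ)
  continuousOn_fderiv := h.continuousOn_fderiv.mono (prod_mono (Iio_subset_Iio hτ) Subset.rfl)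
  continuousOn_laplacian := h.continuousOn_laplacian.mono (prod_mono (Iio_subset_Iio hτ) Subset.rfl)
  axisymmetric t ht := h.axisymmetric t (lt_of_lt_of_le ht hτ)
  axis t ht := h.axis t (lt_of_lt_of_le ht hτ)
  abs_le t ht := h.abs_le t (lt_of_lt_of_le ht hτ)
  radial_nonneg t ht := h.radial_nonneg t (lt_of_lt_of_le ht hτ)
  measurable_drift := h.measurable_drift
  smooth_drift t ht := h.smooth_drift t (lt_of_lt_of_le ht hτ)
  divFree t ht := h.divFree t (lt_of_lt_of_le ht hτ)
  drift_le t ht := h.drift_le t (lt_of_lt_of_le ht hτ)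
  measurable_beta := h.measurable_beta
  A_nonneg := h.A_nonneg
  beta_le_radial t ht := h.beta_le_radial t (lt_of_lt_of_le ht hτ)
  beta_le_time t ht x := by
    have h1 : Real.sqrt (τ' - t) ≤ Real.sqrt (τ - t) := Real.sqrt_le_sqrt (by linarith)
    exact (mul_le_mul_of_nonneg_left h1 (abs_nonneg _)).trans (h.beta_le_time t (lt_of_lt_of_le ht hτ) x)
  eqn x hx s t hst ht := h.eqn x hx s t hst (lt_of_lt_of_le ht hτ)

/-! ### Scaling and translation covariance -/

/-- **Scaling and translation covariance** (KNSS (5.11)–(5.13), tree `IsKNSSSwirlPair.rescale`, with the extra drift rescaled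
like a velocity, `B(s,y) = λ β(Φ(s,y))`): with `Φ(s, y) = (t* − λ²T + λ² s, z̄ e_z + λ y)` the triple
`(f ∘ Φ, λ (u ∘ Φ), λ (β ∘ Φ))` is a sourced swirl triple with the same constants up to the time `T + (τ − t*)/λ²`. -/
theorem rescale (h : IsSourcedSwirl Cf Cu A τ f u β) {lam : ℝ} (hlam : 0 < lam) (tstar zbar T : ℝ) :
    IsSourcedSwirl Cf Cu A (T + (τ - tstar) / lam ^ 2)
      (stPull (lam ^ 2) lam (tstar - lam ^ 2 * T) (zbar • eZ) f)
      (lam • stPull (lam ^ 2) lam (tstar - lam ^ 2 * T) (zbar • eZ) u)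
      (lam • stPull (lam ^ 2) lam (tstar - lam ^ 2 * T) (zbar • eZ) β) := by
  -- the KNSS part of the data rescales by the tree's theorem applied to the pair `(f, u)` with the UNSOURCED fields; we redo
  -- the bookkeeping directly (the equation differs)
  set b : ℝ := lam ^ 2 with hb
  set t₀ : ℝ := tstar - lam ^ 2 * T with ht₀
  set x₀ : (EuclideanSpace ℝ (Fin 3)) := zbar • eZ with hx₀
  have hbpos : 0 < b := by positivity
  have hlam0 : lam ≠ 0 := hlam.ne'
  have htime : ∀ s, s < T + (τ - tstar) / lam ^ 2 ↔ t₀ + b * s < τ := by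
    intro s
    rw [ht₀, hb]
    constructor
    · intro hs
      have := (lt_div_iff₀ (by positivity : (0 : ℝ) < lam ^ 2)).1 (by linarith : s - T < (τ - tstar) / lam ^ 2)
      nlinarith
    · intro hs
      have h1 : (s - T) * lam ^ 2 < τ - tstar := by nlinarith
      have := (lt_div_iff₀ (by positivity : (0 : ℝ) < lam ^ 2)).2 h1
      linarith
  have htimeeq : ∀ s, τ - (t₀ + b * s) = lam ^ 2 * (T + (τ - tstar) / lam ^ 2 - s) := by
    intro s; rw [ht₀, hb]; field_simp; ring
  have hX : ∀ y : (EuclideanSpace ℝ (Fin 3)), cylRadius (x₀ + lam • y) = lam * cylRadius y := fun y => by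
    rw [hx₀, cylRadius_smul_eZ_add_smul, abs_of_pos hlam]
  have heRX : ∀ y : (EuclideanSpace ℝ (Fin 3)), eR (x₀ + lam • y) = eR y := fun y => eR_smul_eZ_add_smul zbar hlam y
  have hΦc : Continuous fun p : ℝ × (EuclideanSpace ℝ (Fin 3)) => (t₀ + b * p.1, x₀ + lam • p.2) := by fun_prop
  have hΦmaps : MapsTo (fun p : ℝ × (EuclideanSpace ℝ (Fin 3)) => (t₀ + b * p.1, x₀ + lam • p.2))
      (Iio (T + (τ - tstar) / lam ^ 2) ×ˢ univ) (Iio τ ×ˢ univ) :=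
    fun p hp => ⟨(htime p.1).1 hp.1, mem_univ _⟩
  refine ⟨?_, ?_, ?_, ?_, ?_, ?_, ?_, ?_, ?_, ?_, ?_, ?_, h.A_nonneg, ?_, ?_, ?_⟩
  · intro s hs
    exact (h.smooth _ ((htime s).1 hs)).comp (contDiff_const.add (contDiff_const_smul lam))
  · have hc := (h.continuousOn_fderiv.comp hΦc.continuousOn hΦmaps).const_smul lam
    refine hc.congr fun p _ => ?_
    simp only [Pi.smul_apply, comp_apply]
    exact fderiv_stPull b lam t₀ x₀ f p.1 p.2
  · have hc := (h.continuousOn_laplacian.comp hΦc.continuousOn hΦmaps).const_smul (lam ^ 2)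
    refine hc.congr fun p hp => ?_
    have h2 : ContDiff ℝ 2 (f (t₀ + b * p.1)) :=
      (h.smooth _ ((htime p.1).1 hp.1)).of_le (by norm_cast)
    simp only [Pi.smul_apply, comp_apply, smul_eq_mul]
    rw [laplacian_stPull b lam t₀ x₀ f p.1 p.2 h2, smul_eq_mul]
  · intro s hs θ y
    simp only [stPull_apply]
    rw [hx₀, ← SereginSverak2009.rotZ_smul_eZ_add_smul, h.axisymmetric _ ((htime s).1 hs) θ]
  · intro s hs y hy
    simp only [stPull_apply]
    exact h.axis _ ((htime s).1 hs) _ (by rw [hX, hy, mul_zero])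
  · intro s hs y
    simp only [stPull_apply]
    exact h.abs_le _ ((htime s).1 hs) _
  · -- radial monotonicity: `D(f∘Φ)(y)[e_r y] = λ Df(Φy)[e_r (Φ y)] ≥ 0`
    intro s hs y
    rw [fderiv_stPull b lam t₀ x₀ f s y]
    rw [_root_.smul_apply, smul_eq_mul]
    rw [← heRX y]
    exact mul_nonneg hlam.le (h.radial_nonneg _ ((htime s).1 hs) _)
  · have hm : Measurable fun p : ℝ × (EuclideanSpace ℝ (Fin 3)) => (t₀ + b * p.1, x₀ + lam • p.2) := hΦc.measurable
    have hunc : uncurry (lam • stPull b lam t₀ x₀ u) =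
        fun p : ℝ × (EuclideanSpace ℝ (Fin 3)) => lam • uncurry u (t₀ + b * p.1, x₀ + lam • p.2) := by
      funext p; rfl
    rw [hunc]
    exact (h.measurable_drift.comp hm).const_smul lam
  · intro s hs
    have hu := h.smooth_drift _ ((htime s).1 hs)
    have hfun : (lam • stPull b lam t₀ x₀ u) s = fun y => lam • u (t₀ + b * s) (x₀ + lam • y) := by
      funext y; rfl
    rw [hfun]
    exact (hu.comp (contDiff_const.add (contDiff_const_smul lam))).const_smul lam
  · intro s hs y
    have hfun : (lam • stPull b lam t₀ x₀ u) s = lam • stPull b lam t₀ x₀ u s := rfl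
    rw [hfun]
    have hd : DifferentiableAt ℝ (stPull b lam t₀ x₀ u s) y := by
      have hu := h.smooth_drift _ ((htime s).1 hs)
      exact ((hu.comp (contDiff_const.add (contDiff_const_smul lam))).differentiable
        (by simp)) y
    rw [VectorCalculus.divergence, fderiv_const_smul hd, ContinuousLinearMap.toLinearMap_smul,
      LinearMap.map_smul, smul_eq_mul]
    have := divergence_stPull b lam t₀ x₀ u s y
    rw [VectorCalculus.divergence] at this
    rw [this, h.divFree _ ((htime s).1 hs) _, mul_zero, mul_zero]
  · intro s hs y
    simp only [smul_stPull_apply, norm_smul, Real.norm_eq_abs, abs_of_pos hlam]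
    have hbd := h.drift_le _ ((htime s).1 hs) (x₀ + lam • y)
    rw [hX] at hbd
    nlinarith [hbd, cylRadius_nonneg y, norm_nonneg (u (t₀ + b * s) (x₀ + lam • y))]
  · -- measurability of the rescaled extra drift
    have hm : Measurable fun p : ℝ × (EuclideanSpace ℝ (Fin 3)) => (t₀ + b * p.1, x₀ + lam • p.2) := hΦc.measurable
    have hunc : uncurry (lam • stPull b lam t₀ x₀ β) =
        fun p : ℝ × (EuclideanSpace ℝ (Fin 3)) => lam • uncurry β (t₀ + b * p.1, x₀ + lam • p.2) := by
      funext p; rfl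
    rw [hunc]
    exact (h.measurable_beta.comp hm).const_smul lam
  · -- `|B| r ≤ A`
    intro s hs y
    have e1 : (lam • stPull b lam t₀ x₀ β) s y = lam * β (t₀ + b * s) (x₀ + lam • y) := by
      simp only [smul_stPull_apply, smul_eq_mul]
    rw [e1, abs_mul, abs_of_pos hlam]
    have hbd := h.beta_le_radial _ ((htime s).1 hs) (x₀ + lam • y)
    rw [hX] at hbd
    nlinarith [hbd, cylRadius_nonneg y, abs_nonneg (β (t₀ + b * s) (x₀ + lam • y))]
  · -- `|B| √(τ_new − s) ≤ A`
    intro s hs y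
    have e1 : (lam • stPull b lam t₀ x₀ β) s y = lam * β (t₀ + b * s) (x₀ + lam • y) := by
      simp only [smul_stPull_apply, smul_eq_mul]
    rw [e1, abs_mul, abs_of_pos hlam]
    have hbd := h.beta_le_time _ ((htime s).1 hs) (x₀ + lam • y)
    rw [htimeeq s, Real.sqrt_mul (by positivity), Real.sqrt_sq hlam.le] at hbd
    nlinarith [hbd]
  · -- the equation: substitute `τ' = t₀ + b σ` in the time integral
    intro y hy s t hst ht
    have hyX : cylRadius (x₀ + lam • y) ≠ 0 := by rw [hX]; exact mul_ne_zero hlam0 hy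
    set X : (EuclideanSpace ℝ (Fin 3)) := x₀ + lam • y with hXdef
    set G : ℝ → ℝ := fun τ' => (Δ (f τ')) X - fderiv ℝ (f τ') X (u τ' X) -
      (2 / cylRadius X + β τ' X) * partialDeriv (eR X) (f τ') X with hG
    have hst' : t₀ + b * s ≤ t₀ + b * t := by nlinarith
    have hsrc : f (t₀ + b * t) X - f (t₀ + b * s) X = ∫ τ' in (t₀ + b * s)..(t₀ + b * t), G τ' :=
      h.eqn X hyX (t₀ + b * s) (t₀ + b * t) hst' ((htime t).1 ht)
    have hint : EqOn (fun σ => (Δ (stPull b lam t₀ x₀ f σ)) y -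
        fderiv ℝ (stPull b lam t₀ x₀ f σ) y ((lam • stPull b lam t₀ x₀ u) σ y) -
          (2 / cylRadius y + (lam • stPull b lam t₀ x₀ β) σ y) *
            partialDeriv (eR y) (stPull b lam t₀ x₀ f σ) y)
        (fun σ => b * G (t₀ + b * σ)) (uIcc s t) := by
      intro σ hσ
      rw [uIcc_of_le hst] at hσ
      have hσ' : t₀ + b * σ < τ := lt_of_le_of_lt (by nlinarith [hσ.2]) ((htime t).1 ht)
      have h2 : ContDiff ℝ 2 (f (t₀ + b * σ)) := (h.smooth _ hσ').of_le (by norm_cast)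
      simp only [hG, smul_stPull_apply]
      rw [laplacian_stPull b lam t₀ x₀ f σ y h2, partialDeriv_apply, partialDeriv_apply,
        fderiv_stPull, heRX, hX]
      simp only [_root_.smul_apply, map_smul, smul_eq_mul, hb]
      rw [← hXdef]
      field_simp
    have hlhs : stPull b lam t₀ x₀ f t y - stPull b lam t₀ x₀ f s y =
        f (t₀ + b * t) X - f (t₀ + b * s) X := rfl
    have hsub := intervalIntegral.smul_integral_comp_add_mul (a := s) (b := t) G b t₀
    rw [hlhs, hsrc, intervalIntegral.integral_congr hint, intervalIntegral.integral_const_mul,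
      ← hsub, smul_eq_mul]

/-- The value of the rescaled scalar at box time `T`: `F(T, y) = f(t*, z̄e_z + λy)` (tree `stPull_rescale_apply_T`). -/
theorem rescale_apply_T (lam tstar zbar T : ℝ) (y : (EuclideanSpace ℝ (Fin 3))) :
    stPull (lam ^ 2) lam (tstar - lam ^ 2 * T) (zbar • eZ) f T y = f tstar (zbar • eZ + lam • y) :=
  stPull_rescale_apply_T lam tstar zbar T f y

/-! ### The data of Lemma 2.1 on a region away from the axis (merged drift `u + (2/r + β) e_r`) -/

/-- **The hypotheses of Lemma 2.1 for a sourced swirl triple on a region away from the axis** (tree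
`IsKNSSSwirlPair.lemma21_data` with the extra radial drift merged in): on `(0, T] × Ω`, `Ω ⊆ {r > 1/2}`, `T < τ`, the drift
`b = u + (2/r + β) e_r` is jointly measurable and bounded by `2C_u + 4 + 2A`, and `g = f + m` is in the elementary solution class
of `KNSS2009_lemma21` with drift `b`. -/
theorem lemma21_data (h : IsSourcedSwirl Cf Cu A τ f u β) {T : ℝ} (hT : T < τ)
    (m : ℝ) {Ω : Set (EuclideanSpace ℝ (Fin 3))} (hΩ : ∀ y ∈ Ω, 1 / 2 < cylRadius y) :
    Measurable (uncurry fun s y => u s y + (2 / cylRadius y + β s y) • eR y) ∧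
    (∀ s ∈ Ioc 0 T, ∀ y ∈ Ω, ‖u s y + (2 / cylRadius y + β s y) • eR y‖ ≤ 2 * Cu + 4 + 2 * A) ∧
    (∀ s ∈ Ioc 0 T, ContDiffOn ℝ 2 (fun y => f s y + m) Ω) ∧
    ContinuousOn (fun p : ℝ × (EuclideanSpace ℝ (Fin 3)) => fderiv ℝ (fun y => f p.1 y + m) p.2) (Ioc 0 T ×ˢ Ω) ∧
    ContinuousOn (fun p : ℝ × (EuclideanSpace ℝ (Fin 3)) => (Δ fun y => f p.1 y + m) p.2) (Ioc 0 T ×ˢ Ω) ∧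
    (∀ y ∈ Ω, ∀ s t : ℝ, 0 < s → s ≤ t → t ≤ T →
      (f t y + m) - (f s y + m) = ∫ r in s..t, ((Δ fun y => f r y + m) y -
        fderiv ℝ (fun y => f r y + m) y (u r y + (2 / cylRadius y + β r y) • eR y))) := by
  have hCu := Cu_nonneg h
  have hA := h.A_nonneg
  have hτ : ∀ s ∈ Ioc (0 : ℝ) T, s < τ := fun s hs => lt_of_le_of_lt hs.2 hT
  have hsub : Ioc (0 : ℝ) T ×ˢ Ω ⊆ Iio τ ×ˢ (univ : Set (EuclideanSpace ℝ (Fin 3))) := fun p hp => ⟨hτ p.1 hp.1, mem_univ _⟩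
  refine ⟨?_, ?_, ?_, ?_, ?_, ?_⟩
  · have h1 : Measurable fun p : ℝ × (EuclideanSpace ℝ (Fin 3)) => (2 / cylRadius p.2 + β p.1 p.2) • eR p.2 :=
      (((measurable_const.div continuous_cylRadius.measurable).comp measurable_snd).add
        h.measurable_beta).smul (measurable_eR.comp measurable_snd)
    exact h.measurable_drift.add h1
  · intro s hs y hy
    have hr := hΩ y hy
    have hr0 : 0 < cylRadius y := by linarith
    have hV : ‖u s y‖ ≤ 2 * Cu := by
      have hb := h.drift_le s (hτ s hs) y
      have : ‖u s y‖ ≤ Cu / cylRadius y := by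
        rw [le_div_iff₀ hr0]; linarith [mul_comm (cylRadius y) ‖u s y‖]
      refine this.trans ?_
      rw [div_le_iff₀ hr0]
      nlinarith
    have hβ : |β s y| ≤ 2 * A := by
      have hb := h.beta_le_radial s (hτ s hs) y
      have : |β s y| ≤ A / cylRadius y := by
        rw [le_div_iff₀ hr0]; exact hb
      refine this.trans ?_
      rw [div_le_iff₀ hr0]
      nlinarith
    have hE : ‖(2 / cylRadius y + β s y) • eR y‖ ≤ 4 + 2 * A := by
      rw [norm_smul, Real.norm_eq_abs]
      have h1 : |2 / cylRadius y + β s y| ≤ 4 + 2 * A := by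
        refine (abs_add_le _ _).trans (add_le_add ?_ hβ)
        rw [abs_of_nonneg (by positivity), div_le_iff₀ hr0]; linarith
      have h2 := norm_eR_le_one y
      calc |2 / cylRadius y + β s y| * ‖eR y‖ ≤ (4 + 2 * A) * 1 := by gcongr
        _ = 4 + 2 * A := by ring
    exact (norm_add_le _ _).trans (by linarith)
  · intro s hs
    exact (((h.smooth s (hτ s hs)).of_le (by norm_cast)).add contDiff_const).contDiffOn
  · refine (h.continuousOn_fderiv.mono hsub).congr fun p _ => ?_
    exact fderiv_add_const m
  · refine (h.continuousOn_laplacian.mono hsub).congr fun p hp => ?_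
    exact laplacian_add_const ((h.smooth p.1 (hτ p.1 hp.1)).of_le (by norm_cast)).contDiffAt m
  · intro y hy s t hs hst htT
    have hr := hΩ y hy
    have hy0 : cylRadius y ≠ 0 := by linarith
    have ht : t < τ := lt_of_le_of_lt htT hT
    rw [add_sub_add_right_eq_sub, h.eqn y hy0 s t hst ht]
    refine intervalIntegral.integral_congr fun r hr' => ?_
    rw [uIcc_of_le hst] at hr'
    have hrτ : r < τ := lt_of_le_of_lt (hr'.2.trans htT) hT
    have h2 : ContDiffAt ℝ 2 (f r) y := ((h.smooth r hrτ).of_le (by norm_cast)).contDiffAt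
    simp only [laplacian_add_const h2, fderiv_add_const, map_add, map_smul, smul_eq_mul,
      partialDeriv_apply]
    ring

/-! ### The supremum of `f` and near-maximum points off the axis -/

/-- The supremum `M = sup {f(t,x) : t < 0}` exists, dominates `f`, is approached, and if `f` takes a positive value then
`M > 0` and near-maximum points are off the axis (tree `IsKNSSSwirlPair.exists_sup`). -/
theorem exists_sup (h : IsSourcedSwirl Cf Cu A 0 f u β) {t₀ : ℝ} (ht₀ : t₀ < 0)
    {x₀ : (EuclideanSpace ℝ (Fin 3))} (hpos : 0 < f t₀ x₀) :
    ∃ M : ℝ, 0 < M ∧ M ≤ Cf ∧ (∀ t < 0, ∀ x, f t x ≤ M) ∧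
      ∀ η > 0, ∃ t < 0, ∃ x, M - η < f t x ∧ (η ≤ M → cylRadius x ≠ 0) := by
  set S : Set ℝ := {v | ∃ t < 0, ∃ x, f t x = v} with hS
  have hbdd : BddAbove S := ⟨Cf, by rintro v ⟨t, ht, x, rfl⟩; exact (le_abs_self _).trans (h.abs_le t ht x)⟩
  have hne : S.Nonempty := ⟨f t₀ x₀, t₀, ht₀, x₀, rfl⟩
  refine ⟨sSup S, ?_, ?_, ?_, ?_⟩
  · exact lt_of_lt_of_le hpos (le_csSup hbdd ⟨t₀, ht₀, x₀, rfl⟩)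
  · exact csSup_le hne (by rintro v ⟨t, ht, x, rfl⟩; exact (le_abs_self _).trans (h.abs_le t ht x))
  · intro t ht x
    exact le_csSup hbdd ⟨t, ht, x, rfl⟩
  · intro η hη
    obtain ⟨v, ⟨t, ht, x, rfl⟩, hv⟩ := exists_lt_of_lt_csSup hne (by linarith : sSup S - η < sSup S)
    refine ⟨t, ht, x, hv, fun hηM hx => ?_⟩
    have h0 := h.axis t ht x hx
    have hM : 0 < sSup S := lt_of_lt_of_le hpos (le_csSup hbdd ⟨t₀, ht₀, x₀, rfl⟩)
    linarith

end IsSourcedSwirl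

end Summit.NavierStokesRegularity.NavierStokesRegularity.Theorems.HalfSpaceWindowDoorCirculationCarryingRigiditySourcedSwirl

end
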